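import Mathlib
import Literature.MathematicalPhysics.QuantumFieldTheory.MirrorClusterOSSpace
import Literature.Analysis.Complex.LaplaceFourierCone
import HarnessLib

/-!
# The bisector frame: half-plane holomorphy of two-cluster functions in a light-cone coordinate

Topic `Literature/MathematicalPhysics/QuantumFieldTheory`.  Let `n, n'` be orthogonal vectors of
equal length in `ℝ^d` and `b = n + n'` the bisector.  The quarter turn of the `(n, n')`-plane is
`θ_b ∘ θ_n`, so a two-cluster function of the frame `n`,

  `R_e(t, s) = Σ_{x,y} ē_x e_y S(θ_n x ⊔ (y + s n' + t n))`   (`rawPairing`),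

read in the light-cone coordinates `u = t + s`, `v = t - s` and after a free translation along
`-λ n'`, is for each fixed real `v` a matrix element `⟪ψ', e^{-((u-u₀)/2) H_b} e^{i(v/2) P_{b₋}} ψ''⟫`
of the frame `b` (`b₋ = n - n' ⊥ b`): hence the restriction to `u > u₀` of a function holomorphic on
the half-plane `Re u > u₀` and bounded there by a constant INDEPENDENT of `v`
(`exists_halfPlane_extension_rawPairing`).  Inputs: the kernel-level OS reconstruction of the frame
`b` (`MirrorOSData S (n + n')`, `MirrorClusterOSSpace.lean`: polarization, joint spectral measures)
and the half-plane holomorphy of Laplace transforms (`LaplaceFourierCone.lean`).  This is step (2)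
of the in-plane light-cone argument (Glimm–Jaffe §19.5 inverted; Fröhlich–Israel–Lieb–Simon 1978 §3
for reflection positivity in diagonal planes).

* `rawPairing`, `rawPairing_eq_clusterPairing` (`t ≥ 0`), `rawPairing_neg_right` (`n' ↦ -n'` is
  `s ↦ -s`);
* geometry of the bisector (`inner_bisector_*`, `reflection_bisector_*`);
* `exists_halfPlane_extension_rawPairing`.

## References
* J. Glimm, A. Jaffe, *Quantum Physics* (2nd ed. 1987), §19.5. [folklore]
* J. Fröhlich, R. Israel, E. H. Lieb, B. Simon, Comm. Math. Phys. 62 (1978) 1–34, §3. [folklore]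
-/

noncomputable section

open scoped InnerProductSpace BigOperators ComplexConjugate
open Literature.Probability.LatticeModels Literature.Analysis.Complex Finset MeasureTheory Complex Set

namespace Literature.MathematicalPhysics.QuantumFieldTheory

variable {d : ℕ}

/-! ### The raw two-cluster function -/

/-- **The raw two-cluster function of the frame `(n, n')`** at a finitely supported complex functional
`e`: `R_e(t, s) = Σ_{x,y ∈ supp e} ē_x e_y S(θ_n x ⊔ (y + s n' + t n))`, for ALL real `t, s` (no
half-space bookkeeping; for `t ≥ 0` it is the diagonal two-cluster function
`clusterPairing S n' hn' e e t s = ⟪ψ_e, e^{-tH} e^{isP} ψ_e⟫`). [folklore] -/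
def rawPairing (S : CorrFamily d) (n n' : EuclideanSpace ℝ (Fin d)) (e : HalfSpaceCluster d n →₀ ℂ)
    (t s : ℝ) : ℂ :=
  ∑ x ∈ e.support, ∑ y ∈ e.support, conj (e x) * e y *
    ((S (x.k + y.k) (Fin.append (fun i => (ℝ ∙ n)ᗮ.reflection (x.pts i))
      (fun j => y.pts j + (s • n' + t • n))) : ℝ) : ℂ)

/-- For `t ≥ 0` the raw function is the diagonal two-cluster function. [folklore] -/
theorem rawPairing_eq_clusterPairing (S : CorrFamily d) {n : EuclideanSpace ℝ (Fin d)}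
    (n' : EuclideanSpace ℝ (Fin d)) (hn' : ⟪n', n⟫_ℝ = 0) (e : HalfSpaceCluster d n →₀ ℂ) {t : ℝ}
    (ht : 0 ≤ t) (s : ℝ) : rawPairing S n n' e t s = clusterPairing S n' hn' e e t s := by
  rw [clusterPairing_eq_sum]
  refine Finset.sum_congr rfl fun x _ => Finset.sum_congr rfl fun y _ => ?_
  simp only [mirrorKernel, HalfSpaceCluster.shift_k, HalfSpaceCluster.shift_pts, max_eq_left ht]

/-- Replacing `n'` by `-n'` is `s ↦ -s`. [folklore] -/
theorem rawPairing_neg_right (S : CorrFamily d) (n n' : EuclideanSpace ℝ (Fin d))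
    (e : HalfSpaceCluster d n →₀ ℂ) (t s : ℝ) : rawPairing S n (-n') e t s = rawPairing S n n' e t (-s) := by
  simp only [rawPairing, smul_neg, neg_smul]

/-! ### Geometry of the bisector -/

section Geometry

variable {n n' : EuclideanSpace ℝ (Fin d)} (hn' : ⟪n', n⟫_ℝ = 0) (hlen : ‖n‖ = ‖n'‖)
include hn'

/-- `θ_n` is symmetric: `⟪θ_n w, z⟫ = ⟪w, θ_n z⟫`. [folklore] -/
theorem inner_reflection_comm (w z : EuclideanSpace ℝ (Fin d)) :
    ⟪(ℝ ∙ n)ᗮ.reflection w, z⟫_ℝ = ⟪w, (ℝ ∙ n)ᗮ.reflection z⟫_ℝ := by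
  have := hn'
  conv_lhs => rw [← Submodule.reflection_reflection (ℝ ∙ n)ᗮ z]
  rw [LinearIsometryEquiv.inner_map_map]

/-- `θ_n (n + n') = -n + n'`. [folklore] -/
theorem reflection_bisector : (ℝ ∙ n)ᗮ.reflection (n + n') = -n + n' := by
  rw [map_add, mirrorReflection_normal, mirrorReflection_of_inner_eq_zero hn']

include hlen

/-- `⟪n - n', n + n'⟫ = 0` (equal lengths). [folklore] -/
theorem inner_cobisector_bisector : ⟪n - n', n + n'⟫_ℝ = 0 := by
  rw [inner_sub_left, inner_add_right, inner_add_right, real_inner_self_eq_norm_sq,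
    real_inner_self_eq_norm_sq, real_inner_comm n' n, hn', hlen]
  ring

/-- `⟪n', n + n'⟫ = ‖n‖²`. [folklore] -/
theorem inner_right_bisector : ⟪n', n + n'⟫_ℝ = ‖n‖ ^ 2 := by
  rw [inner_add_right, hn', real_inner_self_eq_norm_sq, hlen, zero_add]

/-- `⟪n', n - n'⟫ = -‖n‖²`. [folklore] -/
theorem inner_right_cobisector : ⟪n', n - n'⟫_ℝ = -‖n‖ ^ 2 := by
  rw [inner_sub_right, hn', real_inner_self_eq_norm_sq, hlen, zero_sub]

/-- `⟪n + n', n + n'⟫ = 2‖n‖²`. [folklore] -/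
theorem inner_bisector_self : ⟪n + n', n + n'⟫_ℝ = 2 * ‖n‖ ^ 2 := by
  rw [real_inner_self_eq_norm_sq, ← real_inner_self_eq_norm_sq, inner_add_left, inner_add_right,
    inner_add_right, real_inner_self_eq_norm_sq, real_inner_self_eq_norm_sq, real_inner_comm n' n, hn', hlen]
  ring

/-- The normal component, in the frame `b = n + n'`, of the quarter-turned translated point
`θ_b θ_n (x - λ n')`: it is `⟪x, n - n'⟫ + λ ‖n‖²`. [folklore] -/
theorem inner_quarterTurn_bisector (x : EuclideanSpace ℝ (Fin d)) (lam : ℝ) :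
    ⟪(ℝ ∙ (n + n'))ᗮ.reflection ((ℝ ∙ n)ᗮ.reflection (x - lam • n')), n + n'⟫_ℝ =
      ⟪x, n - n'⟫_ℝ + lam * ‖n‖ ^ 2 := by
  rw [inner_mirrorReflection_normal, inner_reflection_comm hn', reflection_bisector hn', inner_sub_left,
    real_inner_smul_left, inner_add_right, inner_add_right, inner_neg_right, inner_neg_right, hn',
    real_inner_self_eq_norm_sq, ← hlen, inner_sub_right]
  ring

/-- The normal component, in the frame `b`, of the translated second point
`y - λ n' + (u₀/2) b`: it is `⟪y, b⟫ + (u₀ - λ) ‖n‖²`. [folklore] -/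
theorem inner_translate_bisector (y : EuclideanSpace ℝ (Fin d)) (lam u₀ : ℝ) :
    ⟪y - lam • n' + (u₀ / 2) • (n + n'), n + n'⟫_ℝ = ⟪y, n + n'⟫_ℝ + (u₀ - lam) * ‖n‖ ^ 2 := by
  rw [inner_add_left, inner_sub_left, real_inner_smul_left, real_inner_smul_left,
    inner_right_bisector hn' hlen, inner_bisector_self hn' hlen]
  ring

end Geometry

/-! ### The half-plane extension -/

section HalfPlane

variable {S : CorrFamily d} {n n' : EuclideanSpace ℝ (Fin d)}

/-- **Choice of the translation `λ` and of the threshold `u₀`** for a finitely supported functional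
`e`: after translating by `-λ n'` all quarter-turned bra points and all time-shifted ket points
(times `u ≥ u₀` in the light-cone coordinate) lie strictly inside the half-space of the bisector
`b = n + n'`. [folklore] -/
theorem exists_translation_threshold (hn : n ≠ 0) (hn' : ⟪n', n⟫_ℝ = 0) (hlen : ‖n‖ = ‖n'‖)
    (e : HalfSpaceCluster d n →₀ ℂ) :
    ∃ lam u₀ : ℝ, 0 ≤ u₀ ∧
      (∀ x ∈ e.support, ∀ i, 0 < ⟪(ℝ ∙ (n + n'))ᗮ.reflection ((ℝ ∙ n)ᗮ.reflection (x.pts i - lam • n')), n + n'⟫_ℝ) ∧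
      (∀ y ∈ e.support, ∀ j, 0 < ⟪y.pts j - lam • n' + (u₀ / 2) • (n + n'), n + n'⟫_ℝ) := by
  have hℓ : 0 < ‖n‖ ^ 2 := by positivity
  set P : ℝ := ∑ x ∈ e.support, ∑ i, |⟪x.pts i, n - n'⟫_ℝ| with hP
  set Q : ℝ := ∑ y ∈ e.support, ∑ j, |⟪y.pts j, n + n'⟫_ℝ| with hQ
  have hP0 : 0 ≤ P := Finset.sum_nonneg fun x _ => Finset.sum_nonneg fun i _ => abs_nonneg _
  have hQ0 : 0 ≤ Q := Finset.sum_nonneg fun y _ => Finset.sum_nonneg fun j _ => abs_nonneg _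
  have hPle : ∀ x ∈ e.support, ∀ i, |⟪x.pts i, n - n'⟫_ℝ| ≤ P := fun x hx i =>
    (Finset.single_le_sum (f := fun i => |⟪x.pts i, n - n'⟫_ℝ|) (fun _ _ => abs_nonneg _) (Finset.mem_univ i)).trans
      (Finset.single_le_sum (f := fun x : HalfSpaceCluster d n => ∑ i, |⟪x.pts i, n - n'⟫_ℝ|)
        (fun _ _ => Finset.sum_nonneg fun _ _ => abs_nonneg _) hx)
  have hQle : ∀ y ∈ e.support, ∀ j, |⟪y.pts j, n + n'⟫_ℝ| ≤ Q := fun y hy j =>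
    (Finset.single_le_sum (f := fun j => |⟪y.pts j, n + n'⟫_ℝ|) (fun _ _ => abs_nonneg _) (Finset.mem_univ j)).trans
      (Finset.single_le_sum (f := fun y : HalfSpaceCluster d n => ∑ j, |⟪y.pts j, n + n'⟫_ℝ|)
        (fun _ _ => Finset.sum_nonneg fun _ _ => abs_nonneg _) hy)
  refine ⟨1 + P / ‖n‖ ^ 2, (1 + P / ‖n‖ ^ 2) + 1 + Q / ‖n‖ ^ 2, by positivity, fun x hx i => ?_, fun y hy j => ?_⟩
  · rw [inner_quarterTurn_bisector hn' hlen]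
    have h1 := hPle x hx i
    have h2 : (1 + P / ‖n‖ ^ 2) * ‖n‖ ^ 2 = ‖n‖ ^ 2 + P := by field_simp
    rw [h2]
    linarith [neg_abs_le ⟪x.pts i, n - n'⟫_ℝ]
  · rw [inner_translate_bisector hn' hlen]
    have h1 := hQle y hy j
    have h2 : ((1 + P / ‖n‖ ^ 2) + 1 + Q / ‖n‖ ^ 2 - (1 + P / ‖n‖ ^ 2)) * ‖n‖ ^ 2 = ‖n‖ ^ 2 + Q := by
      field_simp; ring
    rw [h2]
    linarith [neg_abs_le ⟪y.pts j, n + n'⟫_ℝ]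

/-- **The pointwise re-expression in the bisector frame.**  For the quarter-turned bra cluster `x'`
and the translated ket cluster `y''` (frame `b = n + n'`, in-plane direction `b₋ = n - n'`),
`S(θ_n x ⊔ (y + s n' + t n)) = K_b(x', y'' + (v/2) b₋ + ((u - u₀)/2) b)` with `t = (u+v)/2`,
`s = (u-v)/2`, `u ≥ u₀` (translation by `-λ n'` and `θ_b θ_b = 1`). [folklore] -/
theorem append_eq_mirrorKernel_bisector (hT : IsTranslationInvariant S) (hn' : ⟪n', n⟫_ℝ = 0) (hlen : ‖n‖ = ‖n'‖)
    {lam u₀ u v : ℝ} (hu : u₀ ≤ u) (x y : HalfSpaceCluster d n)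
    (hx : ∀ i, 0 < ⟪(ℝ ∙ (n + n'))ᗮ.reflection ((ℝ ∙ n)ᗮ.reflection (x.pts i - lam • n')), n + n'⟫_ℝ)
    (hy : ∀ j, 0 < ⟪y.pts j - lam • n' + (u₀ / 2) • (n + n'), n + n'⟫_ℝ) :
    S (x.k + y.k) (Fin.append (fun i => (ℝ ∙ n)ᗮ.reflection (x.pts i))
        (fun j => y.pts j + (((u - v) / 2) • n' + ((u + v) / 2) • n))) =
      mirrorKernel S (n + n')
        (⟨x.k, fun i => (ℝ ∙ (n + n'))ᗮ.reflection ((ℝ ∙ n)ᗮ.reflection (x.pts i - lam • n')), hx⟩ :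
          HalfSpaceCluster d (n + n'))
        (HalfSpaceCluster.shift (n - n') (inner_cobisector_bisector hn' hlen) ((u - u₀) / 2) (v / 2)
          (⟨y.k, fun j => y.pts j - lam • n' + (u₀ / 2) • (n + n'), hy⟩ : HalfSpaceCluster d (n + n'))) := by
  unfold mirrorKernel
  simp only [HalfSpaceCluster.shift_k, HalfSpaceCluster.shift_pts, Submodule.reflection_reflection,
    max_eq_left (by linarith : (0 : ℝ) ≤ (u - u₀) / 2)]
  rw [← hT (x.k + y.k) (-(lam • n')) (Fin.append (fun i => (ℝ ∙ n)ᗮ.reflection (x.pts i))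
    (fun j => y.pts j + (((u - v) / 2) • n' + ((u + v) / 2) • n)))]
  congr 1
  funext i
  refine Fin.addCases (fun j => ?_) (fun j => ?_) i
  · simp only [Fin.append_left, map_sub, LinearIsometryEquiv.map_smul, mirrorReflection_of_inner_eq_zero hn']
    abel
  · simp only [Fin.append_right]
    module

/-- **Half-plane holomorphy in the light-cone coordinate `u = t + s`.**  Let `n ⊥ n'` have equal
lengths, `n ≠ 0`, and let `S` carry OS data in the frame of the bisector `b = n + n'`.  For every
finitely supported functional `e` on the half-space clusters of `n` there are `u₀ ≥ 0` and `M` such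
that for EVERY real `v` the function `u ↦ R_e((u+v)/2, (u-v)/2)` (`u > u₀`) is the restriction of a
function holomorphic on `{Re u > u₀}` and bounded there by `M` — the matrix element
`⟪ψ', e^{-((u-u₀)/2)H_b} e^{i(v/2)P} ψ''⟫` of the frame `b`, by polarization and the joint spectral
measures. [folklore] -/
theorem exists_halfPlane_extension_rawPairing (hb : MirrorOSData S (n + n')) (hn : n ≠ 0)
    (hn' : ⟪n', n⟫_ℝ = 0) (hlen : ‖n‖ = ‖n'‖) (e : HalfSpaceCluster d n →₀ ℂ) :
    ∃ u₀ M : ℝ, 0 ≤ u₀ ∧ ∀ v : ℝ, ∃ g : ℂ → ℂ, DifferentiableOn ℂ g {u : ℂ | u₀ < u.re} ∧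
      (∀ u : ℂ, u₀ < u.re → ‖g u‖ ≤ M) ∧
      ∀ u : ℝ, u₀ < u → g u = rawPairing S n n' e ((u + v) / 2) ((u - v) / 2) := by
  classical
  obtain ⟨lam, u₀, hu₀, hxs, hys⟩ := exists_translation_threshold hn hn' hlen e
  have hbb : ⟪n - n', n + n'⟫_ℝ = 0 := inner_cobisector_bisector hn' hlen
  -- the relabelling maps into the clusters of the frame `b` (total, by `dite`)
  set φ₁ : HalfSpaceCluster d n → HalfSpaceCluster d (n + n') := fun x =>
    if hx : ∀ i, 0 < ⟪(ℝ ∙ (n + n'))ᗮ.reflection ((ℝ ∙ n)ᗮ.reflection (x.pts i - lam • n')), n + n'⟫_ℝ then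
      ⟨x.k, fun i => (ℝ ∙ (n + n'))ᗮ.reflection ((ℝ ∙ n)ᗮ.reflection (x.pts i - lam • n')), hx⟩
    else ⟨0, Fin.elim0, fun i => i.elim0⟩ with hφ₁
  set φ₂ : HalfSpaceCluster d n → HalfSpaceCluster d (n + n') := fun y =>
    if hy : ∀ j, 0 < ⟪y.pts j - lam • n' + (u₀ / 2) • (n + n'), n + n'⟫_ℝ then
      ⟨y.k, fun j => y.pts j - lam • n' + (u₀ / 2) • (n + n'), hy⟩
    else ⟨0, Fin.elim0, fun i => i.elim0⟩ with hφ₂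
  set e₁ : HalfSpaceCluster d (n + n') →₀ ℂ := Finsupp.mapDomain φ₁ e with he₁
  set e₂ : HalfSpaceCluster d (n + n') →₀ ℂ := Finsupp.mapDomain φ₂ e with he₂
  -- the identity with the two-cluster function of the frame `b`
  have hident : ∀ u v : ℝ, u₀ ≤ u → rawPairing S n n' e ((u + v) / 2) ((u - v) / 2) =
      clusterPairing S (n - n') hbb e₁ e₂ ((u - u₀) / 2) (v / 2) := by
    intro u v hu
    rw [he₁, he₂, clusterPairing_mapDomain, rawPairing]
    refine Finset.sum_congr rfl fun x hx => Finset.sum_congr rfl fun y hy => ?_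
    congr 2
    rw [hφ₁, hφ₂]
    simp only [dif_pos (hxs x hx), dif_pos (hys y hy)]
    exact append_eq_mirrorKernel_bisector hb.translationInvariant hn' hlen hu x y (hxs x hx) (hys y hy)
  -- the four polarization functionals and their spectral measures
  set f : Fin 4 → (HalfSpaceCluster d (n + n') →₀ ℂ) := ![e₂ + e₁, e₂ - e₁, e₂ + I • e₁, e₂ - I • e₁] with hf
  have hμ := fun k => hb.exists_spectralMeasure (n - n') hbb (f k)
  choose μ hμfin hμ0 hμrep hμuniv using hμ
  set w : Fin 4 → ℂ := ![1, -1, I, -I] with hw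
  have hpol : ∀ T σ : ℝ, clusterPairing S (n - n') hbb e₁ e₂ T σ =
      (1 / 4) * ∑ k, w k * clusterPairing S (n - n') hbb (f k) (f k) T σ := by
    intro T σ
    rw [clusterPairing_polarization, Fin.sum_univ_four]
    simp only [hf, hw, Matrix.cons_val_zero, Matrix.cons_val_one, Matrix.cons_val]
    ring
  -- the bound
  set M : ℝ := (1 / 4) * ∑ k, (μ k).real univ with hM
  refine ⟨u₀, M, hu₀, fun v => ?_⟩
  -- the extension for fixed `v`
  set g : ℂ → ℂ := fun u => (1 / 4) * ∑ k, w k *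
    ∫ p, cexp (-((u - u₀) / 2 * p 0) + I * ((v / 2 : ℝ) : ℂ) * p 1) ∂(μ k) with hg
  refine ⟨g, ?_, ?_, ?_⟩
  · -- holomorphy
    have hmaps : MapsTo (fun u : ℂ => (u - u₀) / 2) {u : ℂ | u₀ < u.re} {r : ℂ | 0 < r.re} := by
      intro u hu
      simp only [mem_setOf_eq] at hu ⊢
      rw [Complex.div_re]
      simp
      linarith
    refine (DifferentiableOn.const_mul (DifferentiableOn.fun_sum fun k _ => DifferentiableOn.const_mul ?_ _) _)
    have hdiv : DifferentiableOn ℂ (fun u : ℂ => (u - u₀) / 2) {u : ℂ | u₀ < u.re} :=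
      ((differentiable_id.sub_const (u₀ : ℂ)).div_const 2).differentiableOn
    have := (differentiableOn_integral_cexp_laplace (μ := μ k) (hμ0 k) (v / 2)).comp hdiv hmaps
    simpa [Function.comp_def] using this
  · -- the bound
    intro u hu
    have hre : 0 ≤ ((u - u₀) / 2 : ℂ).re := by
      rw [Complex.div_re]
      simp
      linarith
    have hnorm : ∀ k, ‖∫ p, cexp (-((u - u₀) / 2 * p 0) + I * ((v / 2 : ℝ) : ℂ) * p 1) ∂(μ k)‖ ≤
        (μ k).real univ := fun k => by
      haveI := hμfin k
      exact norm_integral_cexp_laplace_le (hμ0 k) hre (v / 2)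
    have hw1 : ∀ k, ‖w k‖ = 1 := fun k => by fin_cases k <;> simp [hw]
    rw [hg]
    simp only
    rw [norm_mul, hM, show ‖(1 / 4 : ℂ)‖ = 1 / 4 by norm_num]
    gcongr
    refine (norm_sum_le _ _).trans (Finset.sum_le_sum fun k _ => ?_)
    rw [norm_mul, hw1 k, one_mul]
    exact hnorm k
  · -- real points
    intro u hu
    rw [hident u v hu.le, hpol, hg]
    simp only
    congr 1
    refine Finset.sum_congr rfl fun k _ => ?_
    congr 1
    rw [hμrep k ((u - u₀) / 2) (by linarith) (v / 2)]
    refine integral_congr_ae (Filter.Eventually.of_forall fun p => ?_)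
    simp only
    push_cast
    ring_nf

end HalfPlane

end Literature.MathematicalPhysics.QuantumFieldTheory
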